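import Summits.BirchSwinnertonDyer.BirchSwinnertonDyer.Theorems.ClassRecordThreeEulerHalvesAtThreeCartanSupplyCosets
import Summits.BirchSwinnertonDyer.BirchSwinnertonDyer.Theorems.ClassRecordThreeEulerHalvesAtThreeCartanSignLatticeTwo
import HarnessLib

/-!
# SUPPLY from PERMUTATION MODELS, V — `Σ_g χ_W(g) = 0` comes for free from the TRACE IDENTITY

Helper file riding `--supports stmt-BirchSwinnertonDyer-19109` (crux `EulerHalvesAtThree`; UNREGISTERED sub-line `Cruxes/EulerHalvesAtThree/Lines/cartan_corr`,
seat `bsd-idea-10` g12), continuing `…CartanSupplyPermModel ∕ PermSubmodule ∕ IsotypicKernel ∕ Cosets`. On a TRANSITIVE permutation lattice `ℤ^n` (`n ≥ 1`) the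
averaging operator `P = Σ_g g` takes values in the constants (`classSumOne_const`); if `L = ker A` (`A` any linear map with `L` stable) carries the trace identity
`tr(g | L) = χ(g)` then `Σ_g χ(g) = tr(P | L)`, and EITHER `𝟙 ∉ L`, whence `P | L = 0` and `Σ_g χ(g) = 0`, OR `𝟙 ∈ L`, whence `P | L = κ ⊗ 𝟙` has trace `κ(𝟙) = #G`
(`LinearMap.trace_smulRight`) and `A𝟙 = (χ(1)·Σχ − #G)·𝟙 = 0` forces `χ(1) = 1`. So for `χ(1) ≠ 1` — here `χ_W(1) = q ± 1 ≠ 1` for `q ≠ 2` — the field `sum_char` of the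
coset data is REDUNDANT (`sum_char_eq_zero_of_trace_eq`): `CartanCosetTraceSupply` asks per prime `q ∉ {2, 3}` ONLY for the trace identity on `ker A_{χ_W} ⊂ ℤ[G ∕ T]`, `η`
and the two torus lines, and `cartanTorusLatticeSupply_of_cosetTraceSupply : CartanCosetTraceSupply → CartanTorusLatticeSupply` (SUPPLY, the v11 stub of 23422's line
`cartan`, BY NAME; the place `q = 2` is the LEAD's `CartanSignLatticeTwo.cartanTorusLatticeSupply_two`, p690778). HONEST FRAMING: reductions and elementary
linear algebra; SUPPLY ∕ NUM ∕ (F2b♭) ∕ the cruxes are NOT proved; BSD is proved for no curve. [folklore]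
-/

set_option linter.dupNamespace false
set_option autoImplicit false

namespace Summit.BirchSwinnertonDyer.BirchSwinnertonDyer.Theorems.CartanSupply

open Summit.BirchSwinnertonDyer.BirchSwinnertonDyer.Theorems.CartanDegree
open Summit.BirchSwinnertonDyer.BirchSwinnertonDyer.Theorems.CartanTorusCubeCut
open Summit.BirchSwinnertonDyer.BirchSwinnertonDyer.Theorems.CartanCorrespondence

/-! ## §1 The averaging operator on a transitive permutation lattice -/

section general
variable {G : Type*} [Group G] [Fintype G] {n : ℕ} (σ : G →* Equiv.Perm (Fin n))

omit [Fintype G] in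
/-- PROVED: an invariant vector of a transitive permutation lattice is constant. [folklore] -/
theorem invariant_const (hσ : ∀ i j : Fin n, ∃ g, σ g i = j) (ψ : Fin n → ℤ) (hψ : ∀ g, permAct σ g ψ = ψ) (i j : Fin n) : ψ i = ψ j := by
  obtain ⟨g, hg⟩ := hσ i j
  have h := congrFun (hψ g) j
  rw [← hg, permAct_apply_perm] at h
  rw [← hg]; exact h

/-- PROVED: unfolding of the averaging operator `P = classSumOp σ 1 = Σ_g g`. [folklore] -/
theorem classSumOne_apply (φ : Fin n → ℤ) : classSumOp σ 1 φ = ∑ g, permAct σ g φ := by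
  rw [classSumOp_apply]
  exact Finset.sum_congr rfl (fun g _ => by rw [Pi.one_apply, one_smul])

/-- PROVED: `P` is invariant: `h·(Pφ) = Pφ`. [folklore] -/
theorem classSumOne_invariant (h : G) (φ : Fin n → ℤ) : permAct σ h (classSumOp σ 1 φ) = classSumOp σ 1 φ := by
  rw [← classSumOp_equivariant σ 1 (fun _ _ => rfl), classSumOne_apply, classSumOne_apply]
  have hL : ∀ g, permAct σ g (permAct σ h φ) = permAct σ (g * h) φ := fun g => by rw [map_mul, Module.End.mul_apply]
  simp only [hL]
  exact Fintype.sum_equiv (Equiv.mulRight h) (fun g => permAct σ (g * h) φ) (fun g => permAct σ g φ) (fun g => rfl)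

/-- PROVED: on a transitive lattice `Pφ` is the constant vector `(Pφ)(i₀)·𝟙`. [folklore] -/
theorem classSumOne_const (hσ : ∀ i j : Fin n, ∃ g, σ g i = j) (i₀ : Fin n) (φ : Fin n → ℤ) :
    classSumOp σ 1 φ = (classSumOp σ 1 φ i₀) • (fun _ => (1 : ℤ)) := by
  funext i
  rw [Pi.smul_apply, smul_eq_mul, mul_one]
  exact invariant_const σ hσ _ (fun g => classSumOne_invariant σ g φ) i i₀

/-- PROVED: `P𝟙 = #G·𝟙`, read at a coordinate. [folklore] -/
theorem classSumOne_one_apply (i : Fin n) : classSumOp σ 1 (fun _ => (1 : ℤ)) i = Fintype.card G := by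
  rw [classSumOne_apply, Finset.sum_apply]
  have h : ∀ g : G, permAct σ g (fun _ => (1 : ℤ)) i = 1 := fun g => rfl
  simp only [h, Finset.sum_const, Finset.card_univ, nsmul_eq_mul, mul_one]

/-- PROVED: `A𝟙 = (χ(1)·Σ_g χ(g) − #G)·𝟙`. [folklore] -/
theorem isotypicOp_one (χ : G → ℤ) :
    isotypicOp σ χ (fun _ => (1 : ℤ)) = (χ 1 * ∑ g, χ g - Fintype.card G) • (fun _ => (1 : ℤ)) := by
  rw [isotypicOp_apply, classSumOp_apply]
  have h : ∀ g : G, permAct σ g (fun _ => (1 : ℤ)) = fun _ => 1 := fun g => rfl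
  simp only [h]
  rw [← Finset.sum_smul, smul_smul, sub_smul]

end general

/-! ## §2 `Σ_g χ(g) = 0` from the trace identity on `ker A` -/

section trace
variable {G : Type*} [Group G] [Fintype G] {n : ℕ} (σ : G →* Equiv.Perm (Fin n))

/-- PROVED — the main lemma: on a transitive permutation lattice with `n ≥ 1`, the trace identity `tr(g | ker A_χ) = χ(g)` and `χ(1) ≠ 1` force
`Σ_g χ(g) = 0`. [folklore] -/
theorem sum_char_eq_zero_of_trace_eq (hσ : ∀ i j : Fin n, ∃ g, σ g i = j) (i₀ : Fin n) (χ : G → ℤ) (hχ1 : χ 1 ≠ 1)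
    (hst : ∀ g, ∀ φ ∈ LinearMap.ker (isotypicOp σ χ), permAct σ g φ ∈ LinearMap.ker (isotypicOp σ χ))
    (htr : ∀ g, LinearMap.trace ℤ (LinearMap.ker (isotypicOp σ χ)) ((permAct σ g).restrict (hst g)) = χ g) :
    ∑ g, χ g = 0 := by
  -- the sum of the restricted operators, as a map on `ker A`, is the restriction of `P`
  have hcoe : ∀ x : LinearMap.ker (isotypicOp σ χ),
      (((∑ g, (permAct σ g).restrict (hst g)) x : LinearMap.ker (isotypicOp σ χ)) : Fin n → ℤ) = classSumOp σ 1 (x : Fin n → ℤ) := by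
    intro x
    rw [LinearMap.sum_apply, Submodule.coe_sum, classSumOne_apply]
    exact Finset.sum_congr rfl (fun g _ => by rw [LinearMap.coe_restrict_apply])
  have hs : ∑ g, χ g = LinearMap.trace ℤ (LinearMap.ker (isotypicOp σ χ)) (∑ g, (permAct σ g).restrict (hst g)) := by
    rw [map_sum]
    exact Finset.sum_congr rfl (fun g _ => (htr g).symm)
  by_cases h1 : isotypicOp σ χ (fun _ => (1 : ℤ)) = 0
  · -- `𝟙 ∈ ker A`: the trace of `P | ker A` is `#G`, and `A𝟙 = 0` forces `χ(1) = 1`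
    exfalso
    obtain ⟨d, b⟩ := Submodule.basisOfPid (Pi.basisFun ℤ (Fin n)) (LinearMap.ker (isotypicOp σ χ))
    haveI := Module.Free.of_basis b
    haveI := Module.Finite.of_basis b
    have hmem : (fun _ => (1 : ℤ)) ∈ LinearMap.ker (isotypicOp σ χ) := LinearMap.mem_ker.mpr h1
    have hP : (∑ g, (permAct σ g).restrict (hst g)) =
        ((LinearMap.proj i₀ ∘ₗ classSumOp σ 1) ∘ₗ (LinearMap.ker (isotypicOp σ χ)).subtype).smulRight ⟨fun _ => (1 : ℤ), hmem⟩ := by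
      apply LinearMap.ext
      intro x
      apply Subtype.ext
      rw [hcoe, LinearMap.smulRight_apply, Submodule.coe_smul, classSumOne_const σ hσ i₀]
      rfl
    have hN : ∑ g, χ g = Fintype.card G := by
      rw [hs, hP, LinearMap.trace_smulRight, LinearMap.comp_apply, LinearMap.comp_apply, Submodule.subtype_apply,
        LinearMap.proj_apply]
      exact classSumOne_one_apply σ i₀
    have h2 := congrFun (isotypicOp_one σ χ) i₀
    rw [h1, Pi.zero_apply, Pi.smul_apply, smul_eq_mul, mul_one, hN] at h2
    have hG : (Fintype.card G : ℤ) ≠ 0 := by exact_mod_cast Fintype.card_ne_zero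
    have h3 : (χ 1 - 1) * (Fintype.card G : ℤ) = 0 := by linear_combination -h2
    rcases mul_eq_zero.mp h3 with h | h
    · exact hχ1 (by linear_combination h)
    · exact hG h
  · -- `𝟙 ∉ ker A`: `P | ker A = 0`
    have hPx : ∀ x : LinearMap.ker (isotypicOp σ χ), classSumOp σ 1 (x : Fin n → ℤ) = 0 := by
      intro x
      have hm : classSumOp σ 1 (x : Fin n → ℤ) ∈ LinearMap.ker (isotypicOp σ χ) := by
        rw [classSumOne_apply]
        exact Submodule.sum_mem _ (fun g _ => hst g _ x.2)
      rw [classSumOne_const σ hσ i₀] at hm ⊢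
      rw [LinearMap.mem_ker, map_smul] at hm
      rcases smul_eq_zero.mp hm with h0 | h0
      · rw [h0, zero_smul]
      · exact absurd h0 h1
    have hP0 : (∑ g, (permAct σ g).restrict (hst g)) = 0 := by
      apply LinearMap.ext
      intro x
      apply Subtype.ext
      rw [hcoe, hPx, LinearMap.zero_apply, Submodule.coe_zero]
    rw [hs, hP0, map_zero]

end trace

/-! ## §3 `χ_W(1) ≠ 1` away from `q = 2`; coset trace data; SUPPLY by name -/

variable {q : ℕ} [Fact q.Prime]

/-- PROVED: `χ_W(1) = q + 1` resp. `q − 1`, so `χ_W(1) ≠ 1` for `q ≠ 2`. [folklore] -/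
theorem char_one_ne_one (hq2 : q ≠ 2) : cubicNewvectorChar q 1 ≠ 1 := by
  have hq : 2 ≤ q := (Fact.out : q.Prime).two_le
  have hq3 : 3 ≤ q := by omega
  unfold cubicNewvectorChar
  rw [Units.val_one, PS.charMat_of_isScalar PS.isScalarMat_one]
  have h3 : (3 : ℤ) ≤ (q : ℤ) := by exact_mod_cast hq3
  split_ifs <;> omega

/-- A SPLIT COSET TRACE DATUM at `q ≡ 1 (mod 3)`: the trace identity on `ker A_{χ_W} ⊂ ℤ[G ∕ T_s]`, `η`, the two torus lines — and nothing else. -/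
structure CartanSplitCosetTraceDatum (q : ℕ) [Fact q.Prime] where
  mod_three : q % 3 = 1
  /-- traces of the action on the isotypic kernel `= χ_{W_q}` (`W_q` once in `ℚ[G ∕ T_s]`). -/
  trace_eq : ∀ g, LinearMap.trace ℤ (LinearMap.ker (isotypicOp (cosetPerm (splitTorusSub q)) (cubicNewvectorChar q)))
    ((permAct (cosetPerm (splitTorusSub q)) g).restrict (ker_isotypicOp_stable (cosetPerm (splitTorusSub q)) g)) = cubicNewvectorChar q g
  /-- the non-split torus `𝔽_q[η]^×`. -/
  η : Mat q
  η_irred : ¬ HasRatEigenvalue η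
  /-- generators of the two torus-fixed lines of the kernel. -/
  φS : Fin (Nat.card (G q ⧸ splitTorusSub q)) → ℤ
  φC : Fin (Nat.card (G q ⧸ splitTorusSub q)) → ℤ
  φS_mem : isotypicOp (cosetPerm (splitTorusSub q)) (cubicNewvectorChar q) φS = 0
  φC_mem : isotypicOp (cosetPerm (splitTorusSub q)) (cubicNewvectorChar q) φC = 0
  φS_fixed : ∀ g : G q, (g : Mat q) 0 1 = 0 → (g : Mat q) 1 0 = 0 → permAct (cosetPerm (splitTorusSub q)) g φS = φS
  φC_fixed : ∀ g : G q, (g : Mat q) * η = η * g → permAct (cosetPerm (splitTorusSub q)) g φC = φC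
  φS_gen : ∀ φ : Fin (Nat.card (G q ⧸ splitTorusSub q)) → ℤ, isotypicOp (cosetPerm (splitTorusSub q)) (cubicNewvectorChar q) φ = 0 →
    (∀ g : G q, (g : Mat q) 0 1 = 0 → (g : Mat q) 1 0 = 0 → permAct (cosetPerm (splitTorusSub q)) g φ = φ) → ∃ m : ℤ, φ = m • φS
  φC_gen : ∀ φ : Fin (Nat.card (G q ⧸ splitTorusSub q)) → ℤ, isotypicOp (cosetPerm (splitTorusSub q)) (cubicNewvectorChar q) φ = 0 →
    (∀ g : G q, (g : Mat q) * η = η * g → permAct (cosetPerm (splitTorusSub q)) g φ = φ) → ∃ m : ℤ, φ = m • φC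
  φS_ne : φS ≠ 0
  φC_ne : φC ≠ 0

/-- A NON-SPLIT COSET TRACE DATUM at `q ≡ 2 (mod 3)`: the trace identity on `ker A_{χ_W} ⊂ ℤ[G ∕ C(η)]`, the two torus lines — and nothing else. -/
structure CartanNonsplitCosetTraceDatum (q : ℕ) [Fact q.Prime] where
  mod_three : q % 3 = 2
  /-- the non-split torus `𝔽_q[η]^×`. -/
  η : Mat q
  η_irred : ¬ HasRatEigenvalue η
  /-- traces of the action on the isotypic kernel `= χ_{W_q}` (`W_q` once in `ℚ[G ∕ T_C]`). -/
  trace_eq : ∀ g, LinearMap.trace ℤ (LinearMap.ker (isotypicOp (cosetPerm (centralizerSub η)) (cubicNewvectorChar q)))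
    ((permAct (cosetPerm (centralizerSub η)) g).restrict (ker_isotypicOp_stable (cosetPerm (centralizerSub η)) g)) = cubicNewvectorChar q g
  /-- generators of the two torus-fixed lines of the kernel. -/
  φS : Fin (Nat.card (G q ⧸ centralizerSub η)) → ℤ
  φC : Fin (Nat.card (G q ⧸ centralizerSub η)) → ℤ
  φS_mem : isotypicOp (cosetPerm (centralizerSub η)) (cubicNewvectorChar q) φS = 0
  φC_mem : isotypicOp (cosetPerm (centralizerSub η)) (cubicNewvectorChar q) φC = 0
  φS_fixed : ∀ g : G q, (g : Mat q) 0 1 = 0 → (g : Mat q) 1 0 = 0 → permAct (cosetPerm (centralizerSub η)) g φS = φS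
  φC_fixed : ∀ g : G q, (g : Mat q) * η = η * g → permAct (cosetPerm (centralizerSub η)) g φC = φC
  φS_gen : ∀ φ : Fin (Nat.card (G q ⧸ centralizerSub η)) → ℤ, isotypicOp (cosetPerm (centralizerSub η)) (cubicNewvectorChar q) φ = 0 →
    (∀ g : G q, (g : Mat q) 0 1 = 0 → (g : Mat q) 1 0 = 0 → permAct (cosetPerm (centralizerSub η)) g φ = φ) → ∃ m : ℤ, φ = m • φS
  φC_gen : ∀ φ : Fin (Nat.card (G q ⧸ centralizerSub η)) → ℤ, isotypicOp (cosetPerm (centralizerSub η)) (cubicNewvectorChar q) φ = 0 →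
    (∀ g : G q, (g : Mat q) * η = η * g → permAct (cosetPerm (centralizerSub η)) g φ = φ) → ∃ m : ℤ, φ = m • φC
  φS_ne : φS ≠ 0
  φC_ne : φC ≠ 0

/-- **COSET TRACE SUPPLY**: every prime `q ∉ {2, 3}` carries the coset trace datum of its residue class mod 3. [folklore] -/
@[conjecture]
def CartanCosetTraceSupply : Prop := ∀ q : ℕ, ∀ _hq : Fact q.Prime, q ≠ 3 → q ≠ 2 →
  (q % 3 = 1 → Nonempty (CartanSplitCosetTraceDatum q)) ∧ (q % 3 = 2 → Nonempty (CartanNonsplitCosetTraceDatum q))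

/-- PROVED: `Σ_g χ_W(g) = 0` on the split coset lattice, from the trace identity alone. [folklore] -/
theorem sum_char_of_splitCosetTrace (hq2 : q ≠ 2) (D : CartanSplitCosetTraceDatum q) : ∑ g : G q, cubicNewvectorChar q g = 0 :=
  sum_char_eq_zero_of_trace_eq (cosetPerm (splitTorusSub q)) (cosetPerm_trans (splitTorusSub q))
    ⟨0, Nat.pos_of_ne_zero (card_quot_ne_zero (splitTorusSub q))⟩ (cubicNewvectorChar q) (char_one_ne_one hq2)
    (ker_isotypicOp_stable (cosetPerm (splitTorusSub q))) D.trace_eq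

/-- PROVED: `Σ_g χ_W(g) = 0` on the non-split coset lattice, from the trace identity alone. [folklore] -/
theorem sum_char_of_nonsplitCosetTrace (hq2 : q ≠ 2) (D : CartanNonsplitCosetTraceDatum q) : ∑ g : G q, cubicNewvectorChar q g = 0 :=
  sum_char_eq_zero_of_trace_eq (cosetPerm (centralizerSub D.η)) (cosetPerm_trans (centralizerSub D.η))
    ⟨0, Nat.pos_of_ne_zero (card_quot_ne_zero (centralizerSub D.η))⟩ (cubicNewvectorChar q) (char_one_ne_one hq2)
    (ker_isotypicOp_stable (cosetPerm (centralizerSub D.η))) D.trace_eq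

/-- PROVED — one prime at a time, split case, `q ≠ 2`. [folklore] -/
theorem cartanTorusLatticeSupplyAt_of_splitCosetTrace (hq2 : q ≠ 2) (D : CartanSplitCosetTraceDatum q) :
    ∃ (𝓛 : CartanTorusLattice q) (wS wC : Fin 𝓛.d → ℤ),
      𝓛.IsSplitFixed wS ∧ 𝓛.IsNonsplitFixed wC ∧
      (∀ v, 𝓛.IsSplitFixed v → ∃ m : ℤ, v = m • wS) ∧ (∀ v, 𝓛.IsNonsplitFixed v → ∃ m : ℤ, v = m • wC) ∧ wS ≠ 0 ∧ wC ≠ 0 :=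
  cartanTorusLatticeSupplyAt_of_splitCoset
    { mod_three := D.mod_three, sum_char := sum_char_of_splitCosetTrace hq2 D, trace_eq := D.trace_eq, η := D.η, η_irred := D.η_irred,
      φS := D.φS, φC := D.φC, φS_mem := D.φS_mem, φC_mem := D.φC_mem, φS_fixed := D.φS_fixed, φC_fixed := D.φC_fixed,
      φS_gen := D.φS_gen, φC_gen := D.φC_gen, φS_ne := D.φS_ne, φC_ne := D.φC_ne }

/-- PROVED — one prime at a time, non-split case, `q ≠ 2`. [folklore] -/
theorem cartanTorusLatticeSupplyAt_of_nonsplitCosetTrace (hq2 : q ≠ 2) (D : CartanNonsplitCosetTraceDatum q) :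
    ∃ (𝓛 : CartanTorusLattice q) (wS wC : Fin 𝓛.d → ℤ),
      𝓛.IsSplitFixed wS ∧ 𝓛.IsNonsplitFixed wC ∧
      (∀ v, 𝓛.IsSplitFixed v → ∃ m : ℤ, v = m • wS) ∧ (∀ v, 𝓛.IsNonsplitFixed v → ∃ m : ℤ, v = m • wC) ∧ wS ≠ 0 ∧ wC ≠ 0 :=
  cartanTorusLatticeSupplyAt_of_nonsplitCoset
    { mod_three := D.mod_three, η := D.η, η_irred := D.η_irred, sum_char := sum_char_of_nonsplitCosetTrace hq2 D, trace_eq := D.trace_eq,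
      φS := D.φS, φC := D.φC, φS_mem := D.φS_mem, φC_mem := D.φC_mem, φS_fixed := D.φS_fixed, φC_fixed := D.φC_fixed,
      φS_gen := D.φS_gen, φC_gen := D.φC_gen, φS_ne := D.φS_ne, φC_ne := D.φC_ne }

omit [Fact q.Prime] in
/-- PROVED — **SUPPLY ⟸ COSET TRACE SUPPLY** (`CartanTorusLatticeSupply` BY NAME; the place `2` is `CartanSignLatticeTwo.cartanTorusLatticeSupply_two`). [folklore] -/
theorem cartanTorusLatticeSupply_of_cosetTraceSupply (h : CartanCosetTraceSupply) : CartanTorusLatticeSupply := by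
  intro q hq h3
  haveI : Fact q.Prime := ⟨hq⟩
  by_cases hq2 : q = 2
  · subst hq2
    exact CartanSignLatticeTwo.cartanTorusLatticeSupply_two
  rcases prime_mod_three hq h3 with h1 | h2
  · exact ((h q ⟨hq⟩ h3 hq2).1 h1).elim fun D => cartanTorusLatticeSupplyAt_of_splitCosetTrace hq2 D
  · exact ((h q ⟨hq⟩ h3 hq2).2 h2).elim fun D => cartanTorusLatticeSupplyAt_of_nonsplitCosetTrace hq2 D

end Summit.BirchSwinnertonDyer.BirchSwinnertonDyer.Theorems.CartanSupply
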